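import Summits.CriticalPhenomena.PercolationContinuityZ3.Theorems.PercNearOneGluingNoHeavyLowerTailSahiGridPatternTwoChart
import Mathlib.Combinatorics.Hall.Basic

/-!
# `NoHeavyLowerTail` (crux stmt-CriticalPhenomena-4575), Sahi programme P1: **THE SHARPENED TWO-CHART TRANSPORT LEMMA, I — HALL
# INJECTIONS AND THE INJECTION COUNT** (generation 30's `CLAIM⁺` / chart-wise `CB⁺`, memo g30 §3.4; proved in generation 31)

Support file (Sahi cell, seat `prim-sahi-p1`, generation 31; `--supports stmt-CriticalPhenomena-4575`).  Pure proofs, NO definitions, no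
`sorry`, standard axioms.  Vocabulary: Mathlib (`IsUpperSet` for the product order on `α × β`, Hall's marriage theorem) and the integer
indicator `ind` of `…SahiGridThreeKernel`.

THE MATHEMATICS (two finite posets `α, β`).  DATA as in `twoChart_sum_nonneg` (`…SahiGridPatternTwoChart`): up-sets `U, b ⊆ b', c ⊆ c'` of
`α × β`; arms `A_b × β ∪ α × G_b ⊆ b`, `A_c × β ∪ α × G_c ⊆ c`; corner sets `D₁, D₂ ⊆ α`, `E₁, E₂ ⊆ β` HK-dominated by the arms of the SMALL
sets `b, c`.  SHARPENED CLAIM (`twoChart_sum_sharp`, companion file `…TwoChartSharp`):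
  `Σ_{(x,y)∈U} [(1_{D₁}(x) − 1_{b'})(1_{E₁}(y) − 1_{c'}) + (1_{E₂}(y) − 1_{b'})(1_{D₂}(x) − 1_{c'})] ≥ 2·#(U ∩ (b'∖b) ∩ (c'∖c))`,
equivalently `t(b,c) ≤ t(b',c) + t(b,c')` for the affine-bilinear two-chart functional `t` with FIXED corners.  PROOF = generation 19's
INJECTION proof A run with two extra kinds of negative units.  By Hall (`exists_upInj_of_hk`: HK-domination `#(V∩D) ≤ #(V∩A)` for all
up-sets `V` ⟺ an injection `κ : D∖A ↪ A∖D` with `x ≤ κ x`) fix `κ` (`D₁ → A_b`), `ι` (`E₁ → G_c`), `κ'` (`D₂ → A_c`), `ι'` (`E₂ → G_b`).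
Negative units of the first chart: ROW sources `S_R = {(x,y) ∈ U ∩ b' ∖ c : x ∉ D₁, y ∈ E₁, (x,y) ∉ c' ∨ (x,y) ∉ b}` ↦ `(x, ι y)`; COLUMN
sources `S_C = {(x,y) ∈ U ∩ c' ∖ b : x ∈ D₁, y ∉ E₁, (x,y) ∉ b' ∨ (x,y) ∉ c}` ↦ `(κ x, y)`; DIAGONAL sources
`S_D = {(x,y) ∈ U ∩ b' ∩ c' ∖ (b ∪ c) : x ∈ D₁, y ∈ E₁}` ↦ `(κ x, ι y)`; all land in the positive units
`P₁ = {(X,Y) ∈ U ∩ b' ∩ c' ∩ (b ∪ c) : X ∉ D₁, Y ∉ E₁}`; diagonal images meet neither row nor column images, and a row/column collision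
`(X,Y)` (forced: `(X, ι⁻¹Y) ∈ b ∖ c'`, `(κ⁻¹X, Y) ∈ c ∖ b'`) is resolved by the second chart's positive unit at `(f X, g Y)`, `f = κ'` on `D₂`
(identity off `D₂`), `g = ι'` on `E₂` — never a primary target of the second chart.  This file proves the resulting ONE-SIDED COUNT
(**`sharp_half_count`**): `#S_R + #S_C + #S_D + #K' ≤ #P₁ + #K`, `K` / `K'` the collision sets of the two charts; the companion file adds
the mirror instance and the pointwise bookkeeping.  Nothing here mentions `sStarD`; nothing asserts `PatternPos d` for any `d ≥ 4`. [this work]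
-/

namespace Summit.CriticalPhenomena.PercolationContinuityZ3.Theorems.SahiGridPattern

open Finset
open scoped BigOperators

section Hall

variable {γ : Type*} [PartialOrder γ] [Fintype γ] [DecidableEq γ]

/-- **HK-domination gives an upward injection** (Hall): if `#(V ∩ D) ≤ #(V ∩ A)` for every up-set `V`, there is a map `κ` sending
`D ∖ A` injectively into `A ∖ D` with `x ≤ κ x`. [this work] -/
theorem exists_upInj_of_hk (D A : Finset γ)
    (hk : ∀ V : Finset γ, IsUpperSet (V : Set γ) → (V ∩ D).card ≤ (V ∩ A).card) :
    ∃ κ : γ → γ, (∀ x, x ∈ D → x ∉ A → κ x ∈ A ∧ κ x ∉ D ∧ x ≤ κ x) ∧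
      (∀ x₁, x₁ ∈ D → x₁ ∉ A → ∀ x₂, x₂ ∈ D → x₂ ∉ A → κ x₁ = κ x₂ → x₁ = x₂) := by
  classical
  let t : (D \ A : Finset γ) → Finset γ := fun x => (A \ D).filter fun a => (x : γ) ≤ a
  have hHall : ∀ s : Finset (D \ A : Finset γ), #s ≤ #(s.biUnion t) := by
    intro s
    set S : Finset γ := s.map (Function.Embedding.subtype _) with hS
    set V : Finset γ := univ.filter fun a => ∃ x ∈ S, x ≤ a with hV
    have hVup : IsUpperSet (V : Set γ) := by
      intro a a' haa' ha
      rw [Finset.mem_coe, Finset.mem_filter] at ha ⊢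
      obtain ⟨x, hx, hxa⟩ := ha.2
      exact ⟨mem_univ _, x, hx, hxa.trans haa'⟩
    have hSsub : S ⊆ D \ A := fun x hx => by
      obtain ⟨y, -, rfl⟩ := Finset.mem_map.1 hx
      exact y.2
    have hSV : S ⊆ V := fun x hx => Finset.mem_filter.2 ⟨mem_univ _, x, hx, le_rfl⟩
    -- `S ⊔ (V ∩ D ∩ A) ⊆ V ∩ D`, disjointly
    have h1 : #S + #(V ∩ D ∩ A) ≤ #(V ∩ D) := by
      rw [← card_union_of_disjoint]
      · refine card_le_card fun a ha => ?_
        rcases Finset.mem_union.1 ha with h | h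
        · exact Finset.mem_inter.2 ⟨hSV h, (Finset.mem_sdiff.1 (hSsub h)).1⟩
        · exact (Finset.mem_inter.1 h).1
      · rw [Finset.disjoint_left]
        intro a ha ha'
        exact (Finset.mem_sdiff.1 (hSsub ha)).2 (Finset.mem_inter.1 ha').2
    -- `V ∩ A = (V ∩ (A ∖ D)) ⊔ (V ∩ D ∩ A)`
    have h2 : #(V ∩ A) = #(V ∩ (A \ D)) + #(V ∩ D ∩ A) := by
      rw [← card_union_of_disjoint]
      · congr 1
        ext a
        simp only [Finset.mem_inter, Finset.mem_union, Finset.mem_sdiff]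
        by_cases h : a ∈ D <;> simp [h]
      · rw [Finset.disjoint_left]
        intro a ha ha'
        exact (Finset.mem_sdiff.1 (Finset.mem_inter.1 ha).2).2 (Finset.mem_inter.1 (Finset.mem_inter.1 ha').1).2
    have h3 : V ∩ (A \ D) ⊆ s.biUnion t := by
      intro a ha
      rw [Finset.mem_inter, Finset.mem_filter] at ha
      obtain ⟨x, hx, hxa⟩ := ha.1.2
      obtain ⟨y, hy, rfl⟩ := Finset.mem_map.1 hx
      exact Finset.mem_biUnion.2 ⟨y, hy, Finset.mem_filter.2 ⟨ha.2, hxa⟩⟩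
    have h4 := hk V hVup
    calc #s = #S := (card_map _).symm
      _ ≤ #(V ∩ (A \ D)) := by omega
      _ ≤ #(s.biUnion t) := card_le_card h3
  obtain ⟨f, hf, hft⟩ := (all_card_le_biUnion_card_iff_exists_injective t).1 hHall
  refine ⟨fun x => if h : x ∈ D \ A then f ⟨x, h⟩ else x, ?_, ?_⟩
  · intro x hxD hxA
    have h : x ∈ D \ A := Finset.mem_sdiff.2 ⟨hxD, hxA⟩
    have hm := hft ⟨x, h⟩
    simp only [t, Finset.mem_filter, Finset.mem_sdiff] at hm
    simp only [dif_pos h]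
    exact ⟨hm.1.1, hm.1.2, hm.2⟩
  · intro x₁ h₁D h₁A x₂ h₂D h₂A h
    have h₁ : x₁ ∈ D \ A := Finset.mem_sdiff.2 ⟨h₁D, h₁A⟩
    have h₂ : x₂ ∈ D \ A := Finset.mem_sdiff.2 ⟨h₂D, h₂A⟩
    simp only [dif_pos h₁, dif_pos h₂] at h
    exact congrArg Subtype.val (hf h)

end Hall

section HalfCount

variable {α β : Type*} [PartialOrder α] [PartialOrder β] [DecidableEq α] [DecidableEq β]

/-- **The one-sided injection count of the sharpened two-chart lemma** (see the module docstring): with Hall injections `κ, ι, κ', ι'`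
in hand, the first chart's negative units (row, column and diagonal sources) plus the second chart's collision set inject into the
first chart's positive units plus the first chart's collision set:  `#S_R + #S_C + #S_D + #K' ≤ #P₁ + #K`. [this work] -/
theorem sharp_half_count (U b c b' c' : Finset (α × β)) (hU : IsUpperSet (U : Set (α × β)))
    (hb : IsUpperSet (b : Set (α × β))) (hc : IsUpperSet (c : Set (α × β)))
    (hb' : IsUpperSet (b' : Set (α × β))) (hc' : IsUpperSet (c' : Set (α × β))) (hbb' : b ⊆ b') (hcc' : c ⊆ c')
    (Ab Ac D₁ D₂ : Finset α) (Gb Gc E₁ E₂ : Finset β)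
    (hAb_b : ∀ x ∈ Ab, ∀ y, (x, y) ∈ b) (hGb_b : ∀ y ∈ Gb, ∀ x, (x, y) ∈ b)
    (hAc_c : ∀ x ∈ Ac, ∀ y, (x, y) ∈ c) (hGc_c : ∀ y ∈ Gc, ∀ x, (x, y) ∈ c)
    (κ κ' : α → α) (ι ι' : β → β)
    (hκ : ∀ x, x ∈ D₁ → x ∉ Ab → κ x ∈ Ab ∧ κ x ∉ D₁ ∧ x ≤ κ x)
    (hκi : ∀ x₁, x₁ ∈ D₁ → x₁ ∉ Ab → ∀ x₂, x₂ ∈ D₁ → x₂ ∉ Ab → κ x₁ = κ x₂ → x₁ = x₂)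
    (hι : ∀ y, y ∈ E₁ → y ∉ Gc → ι y ∈ Gc ∧ ι y ∉ E₁ ∧ y ≤ ι y)
    (hιi : ∀ y₁, y₁ ∈ E₁ → y₁ ∉ Gc → ∀ y₂, y₂ ∈ E₁ → y₂ ∉ Gc → ι y₁ = ι y₂ → y₁ = y₂)
    (hκ' : ∀ x, x ∈ D₂ → x ∉ Ac → κ' x ∈ Ac ∧ κ' x ∉ D₂ ∧ x ≤ κ' x)
    (hι' : ∀ y, y ∈ E₂ → y ∉ Gb → ι' y ∈ Gb ∧ ι' y ∉ E₂ ∧ y ≤ ι' y) :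
    #(U.filter fun p => p ∈ b' ∧ p ∉ c ∧ (p ∉ c' ∨ p ∉ b) ∧ p.1 ∉ D₁ ∧ p.2 ∈ E₁)
      + #(U.filter fun p => p ∈ c' ∧ p ∉ b ∧ (p ∉ b' ∨ p ∉ c) ∧ p.1 ∈ D₁ ∧ p.2 ∉ E₁)
      + #(U.filter fun p => p ∈ b' ∧ p ∈ c' ∧ p ∉ b ∧ p ∉ c ∧ p.1 ∈ D₁ ∧ p.2 ∈ E₁)
      + #(((U.filter fun p => p ∈ c' ∧ p ∉ b ∧ (p ∉ b' ∨ p ∉ c) ∧ p.1 ∉ D₂ ∧ p.2 ∈ E₂).image fun p => (p.1, ι' p.2))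
          ∩ ((U.filter fun p => p ∈ b' ∧ p ∉ c ∧ (p ∉ c' ∨ p ∉ b) ∧ p.1 ∈ D₂ ∧ p.2 ∉ E₂).image fun p => (κ' p.1, p.2)))
    ≤ #(U.filter fun p => p ∈ b' ∧ p ∈ c' ∧ (p ∈ b ∨ p ∈ c) ∧ p.1 ∉ D₁ ∧ p.2 ∉ E₁)
      + #(((U.filter fun p => p ∈ b' ∧ p ∉ c ∧ (p ∉ c' ∨ p ∉ b) ∧ p.1 ∉ D₁ ∧ p.2 ∈ E₁).image fun p => (p.1, ι p.2))
          ∩ ((U.filter fun p => p ∈ c' ∧ p ∉ b ∧ (p ∉ b' ∨ p ∉ c) ∧ p.1 ∈ D₁ ∧ p.2 ∉ E₁).image fun p => (κ p.1, p.2))) := by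
  -- names
  set SR := U.filter fun p => p ∈ b' ∧ p ∉ c ∧ (p ∉ c' ∨ p ∉ b) ∧ p.1 ∉ D₁ ∧ p.2 ∈ E₁ with hSR
  set SC := U.filter fun p => p ∈ c' ∧ p ∉ b ∧ (p ∉ b' ∨ p ∉ c) ∧ p.1 ∈ D₁ ∧ p.2 ∉ E₁ with hSC
  set SD := U.filter fun p => p ∈ b' ∧ p ∈ c' ∧ p ∉ b ∧ p ∉ c ∧ p.1 ∈ D₁ ∧ p.2 ∈ E₁ with hSD
  set P1 := U.filter fun p => p ∈ b' ∧ p ∈ c' ∧ (p ∈ b ∨ p ∈ c) ∧ p.1 ∉ D₁ ∧ p.2 ∉ E₁ with hP1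
  set SR' := U.filter fun p => p ∈ c' ∧ p ∉ b ∧ (p ∉ b' ∨ p ∉ c) ∧ p.1 ∉ D₂ ∧ p.2 ∈ E₂ with hSR'
  set SC' := U.filter fun p => p ∈ b' ∧ p ∉ c ∧ (p ∉ c' ∨ p ∉ b) ∧ p.1 ∈ D₂ ∧ p.2 ∉ E₂ with hSC'
  set R : α × β → α × β := fun p => (p.1, ι p.2) with hR
  set Cm : α × β → α × β := fun p => (κ p.1, p.2) with hCm
  set Dg : α × β → α × β := fun p => (κ p.1, ι p.2) with hDg
  set R' : α × β → α × β := fun p => (p.1, ι' p.2) with hR'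
  set Cm' : α × β → α × β := fun p => (κ' p.1, p.2) with hCm'
  set K := SR.image R ∩ SC.image Cm with hK
  set K' := SR'.image R' ∩ SC'.image Cm' with hK'
  -- the resolution map of the second chart's collisions (lands in `P1`)
  set ρ' : α × β → α × β := fun r => (if r.1 ∈ D₁ then κ r.1 else r.1, if r.2 ∈ E₁ then ι r.2 else r.2) with hρ'
  -- unpacking the source sets
  have mSR : ∀ p, p ∈ SR → p ∈ U ∧ p ∈ b' ∧ p ∉ c ∧ (p ∉ c' ∨ p ∉ b) ∧ p.1 ∉ D₁ ∧ p.2 ∈ E₁ ∧ p.2 ∉ Gc := fun p hp => by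
    rw [hSR, Finset.mem_filter] at hp
    exact ⟨hp.1, hp.2.1, hp.2.2.1, hp.2.2.2.1, hp.2.2.2.2.1, hp.2.2.2.2.2, fun h => hp.2.2.1 (hGc_c _ h _)⟩
  have mSC : ∀ p, p ∈ SC → p ∈ U ∧ p ∈ c' ∧ p ∉ b ∧ (p ∉ b' ∨ p ∉ c) ∧ p.1 ∈ D₁ ∧ p.2 ∉ E₁ ∧ p.1 ∉ Ab := fun p hp => by
    rw [hSC, Finset.mem_filter] at hp
    exact ⟨hp.1, hp.2.1, hp.2.2.1, hp.2.2.2.1, hp.2.2.2.2.1, hp.2.2.2.2.2, fun h => hp.2.2.1 (hAb_b _ h _)⟩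
  have mSD : ∀ p, p ∈ SD → p ∈ U ∧ p ∈ b' ∧ p ∈ c' ∧ p ∉ b ∧ p ∉ c ∧ p.1 ∈ D₁ ∧ p.2 ∈ E₁ ∧ p.1 ∉ Ab ∧ p.2 ∉ Gc := fun p hp => by
    rw [hSD, Finset.mem_filter] at hp
    exact ⟨hp.1, hp.2.1, hp.2.2.1, hp.2.2.2.1, hp.2.2.2.2.1, hp.2.2.2.2.2.1, hp.2.2.2.2.2.2,
      fun h => hp.2.2.2.1 (hAb_b _ h _), fun h => hp.2.2.2.2.1 (hGc_c _ h _)⟩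
  have mP1 : ∀ q : α × β, q ∈ U → q ∈ b' → q ∈ c' → (q ∈ b ∨ q ∈ c) → q.1 ∉ D₁ → q.2 ∉ E₁ → q ∈ P1 := fun q h1 h2 h3 h4 h5 h6 => by
    rw [hP1, Finset.mem_filter]; exact ⟨h1, h2, h3, h4, h5, h6⟩
  have leR : ∀ p : α × β, p.2 ∈ E₁ → p.2 ∉ Gc → p ≤ R p := fun p h1 h2 => ⟨le_rfl, (hι p.2 h1 h2).2.2⟩
  have leCm : ∀ p : α × β, p.1 ∈ D₁ → p.1 ∉ Ab → p ≤ Cm p := fun p h1 h2 => ⟨(hκ p.1 h1 h2).2.2, le_rfl⟩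
  have leDg : ∀ p : α × β, p.1 ∈ D₁ → p.1 ∉ Ab → p.2 ∈ E₁ → p.2 ∉ Gc → p ≤ Dg p := fun p h1 h2 h3 h4 =>
    ⟨(hκ p.1 h1 h2).2.2, (hι p.2 h3 h4).2.2⟩
  -- (1) the three primary maps are injective on their sources and land in `P1`
  have iR : Set.InjOn R SR := by
    intro p hp q hq h
    obtain ⟨-, -, -, -, -, hpE, hpG⟩ := mSR p hp
    obtain ⟨-, -, -, -, -, hqE, hqG⟩ := mSR q hq
    simp only [hR, Prod.mk.injEq] at h
    exact Prod.ext h.1 (hιi _ hpE hpG _ hqE hqG h.2)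
  have iCm : Set.InjOn Cm SC := by
    intro p hp q hq h
    obtain ⟨-, -, -, -, hpD, -, hpA⟩ := mSC p hp
    obtain ⟨-, -, -, -, hqD, -, hqA⟩ := mSC q hq
    simp only [hCm, Prod.mk.injEq] at h
    exact Prod.ext (hκi _ hpD hpA _ hqD hqA h.1) h.2
  have iDg : Set.InjOn Dg SD := by
    intro p hp q hq h
    obtain ⟨-, -, -, -, -, hpD, hpE, hpA, hpG⟩ := mSD p hp
    obtain ⟨-, -, -, -, -, hqD, hqE, hqA, hqG⟩ := mSD q hq
    simp only [hDg, Prod.mk.injEq] at h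
    exact Prod.ext (hκi _ hpD hpA _ hqD hqA h.1) (hιi _ hpE hpG _ hqE hqG h.2)
  have tR : SR.image R ⊆ P1 := by
    intro q hq
    obtain ⟨p, hp, rfl⟩ := Finset.mem_image.1 hq
    obtain ⟨hpU, hpb', -, -, hpD, hpE, hpG⟩ := mSR p hp
    have hle := leR p hpE hpG
    have hc_ : R p ∈ c := hGc_c _ (hι p.2 hpE hpG).1 _
    exact mP1 _ (hU hle hpU) (hb' hle hpb') (hcc' hc_) (Or.inr hc_) hpD (hι p.2 hpE hpG).2.1
  have tCm : SC.image Cm ⊆ P1 := by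
    intro q hq
    obtain ⟨p, hp, rfl⟩ := Finset.mem_image.1 hq
    obtain ⟨hpU, hpc', -, -, hpD, hpE, hpA⟩ := mSC p hp
    have hle := leCm p hpD hpA
    have hb_ : Cm p ∈ b := hAb_b _ (hκ p.1 hpD hpA).1 _
    exact mP1 _ (hU hle hpU) (hbb' hb_) (hc' hle hpc') (Or.inl hb_) (hκ p.1 hpD hpA).2.1 hpE
  have tDg : SD.image Dg ⊆ P1 := by
    intro q hq
    obtain ⟨p, hp, rfl⟩ := Finset.mem_image.1 hq
    obtain ⟨hpU, -, -, -, -, hpD, hpE, hpA, hpG⟩ := mSD p hp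
    have hle := leDg p hpD hpA hpE hpG
    have hb_ : Dg p ∈ b := hAb_b _ (hκ p.1 hpD hpA).1 _
    have hc_ : Dg p ∈ c := hGc_c _ (hι p.2 hpE hpG).1 _
    exact mP1 _ (hU hle hpU) (hbb' hb_) (hcc' hc_) (Or.inl hb_) (hκ p.1 hpD hpA).2.1 (hι p.2 hpE hpG).2.1
  -- (2) diagonal images avoid row images and column images
  have dRD : Disjoint (SR.image R) (SD.image Dg) := by
    rw [Finset.disjoint_left]
    intro r hr hr'
    obtain ⟨p, hp, hpr⟩ := Finset.mem_image.1 hr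
    obtain ⟨q, hq, hqr⟩ := Finset.mem_image.1 hr'
    obtain ⟨-, -, -, hpor, -, hpE, hpG⟩ := mSR p hp
    obtain ⟨-, -, hqc', -, -, hqD, hqE, hqA, hqG⟩ := mSD q hq
    have h : R p = Dg q := hpr.trans hqr.symm
    simp only [hR, hDg, Prod.mk.injEq] at h
    have h2 : p.2 = q.2 := hιi _ hpE hpG _ hqE hqG h.2
    -- `p = (κ q.1, q.2) ≥ q`, so `p ∈ c'` and `p ∈ b`: contradiction with the row-source disjunction
    have hpq : q ≤ p := ⟨by rw [h.1]; exact (hκ q.1 hqD hqA).2.2, by rw [h2]⟩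
    have hpb : p ∈ b := by
      have : (p.1, p.2) ∈ b := by rw [h.1]; exact hAb_b _ (hκ q.1 hqD hqA).1 _
      simpa using this
    rcases hpor with h' | h'
    · exact h' (hc' hpq hqc')
    · exact h' hpb
  have dCD : Disjoint (SC.image Cm) (SD.image Dg) := by
    rw [Finset.disjoint_left]
    intro r hr hr'
    obtain ⟨p, hp, hpr⟩ := Finset.mem_image.1 hr
    obtain ⟨q, hq, hqr⟩ := Finset.mem_image.1 hr'
    obtain ⟨-, -, -, hpor, hpD, -, hpA⟩ := mSC p hp
    obtain ⟨-, hqb', -, -, -, hqD, hqE, hqA, hqG⟩ := mSD q hq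
    have h : Cm p = Dg q := hpr.trans hqr.symm
    simp only [hCm, hDg, Prod.mk.injEq] at h
    have h1 : p.1 = q.1 := hκi _ hpD hpA _ hqD hqA h.1
    have hpq : q ≤ p := ⟨by rw [h1], by rw [h.2]; exact (hι q.2 hqE hqG).2.2⟩
    have hpc : p ∈ c := by
      have : (p.1, p.2) ∈ c := by rw [h.2]; exact hGc_c _ (hι q.2 hqE hqG).1 _
      simpa using this
    rcases hpor with h' | h'
    · exact h' (hb' hpq hqb')
    · exact h' hpc
  -- (3) the second chart's collision points: structure
  have mK' : ∀ r, r ∈ K' → r ∈ U ∧ r ∈ b ∧ r ∈ c ∧ r.1 ∉ Ab ∧ r.2 ∉ Gc ∧ r.1 ∉ D₂ ∧ r.2 ∉ E₂ := by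
    intro r hr
    rw [hK', Finset.mem_inter] at hr
    obtain ⟨p, hp, hpr⟩ := Finset.mem_image.1 hr.1
    obtain ⟨q, hq, hqr⟩ := Finset.mem_image.1 hr.2
    rw [hSR', Finset.mem_filter] at hp
    rw [hSC', Finset.mem_filter] at hq
    obtain ⟨hpU, hpc', hpb, hpor, hpD, hpE⟩ := hp
    obtain ⟨hqU, hqb', hqc, hqor, hqD, hqE⟩ := hq
    have hpG : p.2 ∉ Gb := fun h => hpb (hGb_b _ h _)
    have hqA : q.1 ∉ Ac := fun h => hqc (hAc_c _ h _)
    have e1 : r.1 = κ' q.1 := by rw [← hqr]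
    have e2 : r.2 = ι' p.2 := by rw [← hpr]
    have e3 : r.1 = p.1 := by rw [← hpr]
    have e4 : r.2 = q.2 := by rw [← hqr]
    have hrc : r ∈ c := by
      have : (r.1, r.2) ∈ c := by rw [e1]; exact hAc_c _ (hκ' q.1 hqD hqA).1 _
      simpa using this
    have hrb : r ∈ b := by
      have : (r.1, r.2) ∈ b := by rw [e2]; exact hGb_b _ (hι' p.2 hpE hpG).1 _
      simpa using this
    have hqr_le : q ≤ r := ⟨by rw [e1]; exact (hκ' q.1 hqD hqA).2.2, by rw [e4]⟩
    have hpr_le : p ≤ r := ⟨by rw [e3], by rw [e2]; exact (hι' p.2 hpE hpG).2.2⟩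
    -- `p ∈ c` (as `p.1 = r.1 = κ' q.1 ∈ Ac`), hence `p ∉ b'`; `q ∈ b`, hence `q ∉ c'`
    have hpc : p ∈ c := by
      have : (p.1, p.2) ∈ c := by rw [← e3, e1]; exact hAc_c _ (hκ' q.1 hqD hqA).1 _
      simpa using this
    have hpb' : p ∉ b' := by rcases hpor with h | h; exact h; exact absurd hpc h
    have hqb : q ∈ b := by
      have : (q.1, q.2) ∈ b := by rw [← e4, e2]; exact hGb_b _ (hι' p.2 hpE hpG).1 _
      simpa using this
    have hqc' : q ∉ c' := by rcases hqor with h | h; exact h; exact absurd hqb h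
    refine ⟨hU hqr_le hqU, hrb, hrc, ?_, ?_, ?_, ?_⟩
    · intro h
      have : (p.1, p.2) ∈ b := by rw [← e3]; exact hAb_b _ h _
      exact hpb' (hbb' (by simpa using this))
    · intro h
      have : (q.1, q.2) ∈ c := by rw [← e4]; exact hGc_c _ h _
      exact hqc' (hcc' (by simpa using this))
    · rw [e1]; exact (hκ' q.1 hqD hqA).2.1
    · rw [e2]; exact (hι' p.2 hpE hpG).2.1
  -- the resolution map: values, order, injectivity
  have ρ'1 : ∀ r : α × β, r.1 ∉ Ab → (ρ' r).1 ∉ D₁ ∧ r.1 ≤ (ρ' r).1 := fun r hA => by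
    simp only [hρ']
    by_cases h : r.1 ∈ D₁
    · rw [if_pos h]; exact ⟨(hκ r.1 h hA).2.1, (hκ r.1 h hA).2.2⟩
    · rw [if_neg h]; exact ⟨h, le_rfl⟩
  have ρ'2 : ∀ r : α × β, r.2 ∉ Gc → (ρ' r).2 ∉ E₁ ∧ r.2 ≤ (ρ' r).2 := fun r hG => by
    simp only [hρ']
    by_cases h : r.2 ∈ E₁
    · rw [if_pos h]; exact ⟨(hι r.2 h hG).2.1, (hι r.2 h hG).2.2⟩
    · rw [if_neg h]; exact ⟨h, le_rfl⟩
  have tρ' : K'.image ρ' ⊆ P1 := by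
    intro s hs
    obtain ⟨r, hr, rfl⟩ := Finset.mem_image.1 hs
    obtain ⟨hrU, hrb, hrc, hrA, hrG, -, -⟩ := mK' r hr
    have hle : r ≤ ρ' r := ⟨(ρ'1 r hrA).2, (ρ'2 r hrG).2⟩
    exact mP1 _ (hU hle hrU) (hb' hle (hbb' hrb)) (hc' hle (hcc' hrc)) (Or.inl (hb hle hrb)) (ρ'1 r hrA).1 (ρ'2 r hrG).1
  have iρ' : Set.InjOn ρ' K' := by
    intro r hr s hs h
    obtain ⟨-, -, -, hrA, hrG, -, -⟩ := mK' r hr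
    obtain ⟨-, -, -, hsA, hsG, -, -⟩ := mK' s hs
    simp only [hρ', Prod.mk.injEq] at h
    obtain ⟨h1, h2⟩ := h
    refine Prod.ext ?_ ?_
    · by_cases hr1 : r.1 ∈ D₁ <;> by_cases hs1 : s.1 ∈ D₁ <;> simp only [hr1, hs1, if_true, if_false] at h1
      · exact hκi _ hr1 hrA _ hs1 hsA h1
      · exact absurd (h1 ▸ (hκ r.1 hr1 hrA).1) hsA
      · exact absurd (h1 ▸ (hκ s.1 hs1 hsA).1) hrA
      · exact h1
    · by_cases hr2 : r.2 ∈ E₁ <;> by_cases hs2 : s.2 ∈ E₁ <;> simp only [hr2, hs2, if_true, if_false] at h2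
      · exact hιi _ hr2 hrG _ hs2 hsG h2
      · exact absurd (h2 ▸ (hι r.2 hr2 hrG).1) hsG
      · exact absurd (h2 ▸ (hι s.2 hs2 hsG).1) hrG
      · exact h2
  -- (4) resolution images avoid all primary images
  have dρR : Disjoint (K'.image ρ') (SR.image R) := by
    rw [Finset.disjoint_left]
    intro t ht ht'
    obtain ⟨r, hr, hrt⟩ := Finset.mem_image.1 ht
    obtain ⟨s, hs, hst⟩ := Finset.mem_image.1 ht'
    obtain ⟨-, -, hrc, hrA, hrG, -, -⟩ := mK' r hr
    obtain ⟨-, -, hsc, -, -, hsE, hsG⟩ := mSR s hs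
    have h : ρ' r = R s := hrt.trans hst.symm
    -- `s = (s.1, s.2)` with `s.1 = (ρ' r).1 ≥ r.1` and `ι s.2 = (ρ' r).2`: then `s.2 = r.2`, so `s ≥ r ∈ c`
    have h2 : s.2 = r.2 := by
      have e : (ρ' r).2 = ι s.2 := by rw [h]
      simp only [hρ'] at e
      by_cases hr2 : r.2 ∈ E₁
      · rw [if_pos hr2] at e; exact (hιi _ hr2 hrG _ hsE hsG e).symm
      · rw [if_neg hr2] at e; exact absurd (e ▸ (hι s.2 hsE hsG).1) hrG
    have e1 : (ρ' r).1 = s.1 := by rw [h]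
    have hle : r ≤ s := ⟨by rw [← e1]; exact (ρ'1 r hrA).2, by rw [h2]⟩
    exact hsc (hc hle hrc)
  have dρC : Disjoint (K'.image ρ') (SC.image Cm) := by
    rw [Finset.disjoint_left]
    intro t ht ht'
    obtain ⟨r, hr, hrt⟩ := Finset.mem_image.1 ht
    obtain ⟨s, hs, hst⟩ := Finset.mem_image.1 ht'
    obtain ⟨-, hrb, -, hrA, hrG, -, -⟩ := mK' r hr
    obtain ⟨-, -, hsb, -, hsD, -, hsA⟩ := mSC s hs
    have h : ρ' r = Cm s := hrt.trans hst.symm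
    have h1 : s.1 = r.1 := by
      have e : (ρ' r).1 = κ s.1 := by rw [h]
      simp only [hρ'] at e
      by_cases hr1 : r.1 ∈ D₁
      · rw [if_pos hr1] at e; exact (hκi _ hr1 hrA _ hsD hsA e).symm
      · rw [if_neg hr1] at e; exact absurd (e ▸ (hκ s.1 hsD hsA).1) hrA
    have e2 : (ρ' r).2 = s.2 := by rw [h]
    have hle : r ≤ s := ⟨by rw [h1], by rw [← e2]; exact (ρ'2 r hrG).2⟩
    exact hsb (hb hle hrb)
  have dρD : Disjoint (K'.image ρ') (SD.image Dg) := by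
    rw [Finset.disjoint_left]
    intro t ht ht'
    obtain ⟨r, hr, hrt⟩ := Finset.mem_image.1 ht
    obtain ⟨s, hs, hst⟩ := Finset.mem_image.1 ht'
    obtain ⟨-, hrb, -, hrA, hrG, -, -⟩ := mK' r hr
    obtain ⟨-, -, -, hsb, -, hsD, hsE, hsA, hsG⟩ := mSD s hs
    have h : ρ' r = Dg s := hrt.trans hst.symm
    have h1 : s.1 = r.1 := by
      have e : (ρ' r).1 = κ s.1 := by rw [h]
      simp only [hρ'] at e
      by_cases hr1 : r.1 ∈ D₁
      · rw [if_pos hr1] at e; exact (hκi _ hr1 hrA _ hsD hsA e).symm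
      · rw [if_neg hr1] at e; exact absurd (e ▸ (hκ s.1 hsD hsA).1) hrA
    have h2 : s.2 = r.2 := by
      have e : (ρ' r).2 = ι s.2 := by rw [h]
      simp only [hρ'] at e
      by_cases hr2 : r.2 ∈ E₁
      · rw [if_pos hr2] at e; exact (hιi _ hr2 hrG _ hsE hsG e).symm
      · rw [if_neg hr2] at e; exact absurd (e ▸ (hι s.2 hsE hsG).1) hrG
    have hsr : s = r := Prod.ext h1 h2
    exact hsb (hsr ▸ hrb)
  -- (5) counting
  have cR : #(SR.image R) = #SR := card_image_of_injOn iR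
  have cC : #(SC.image Cm) = #SC := card_image_of_injOn iCm
  have cD : #(SD.image Dg) = #SD := card_image_of_injOn iDg
  have cρ : #(K'.image ρ') = #K' := card_image_of_injOn iρ'
  have hsub : (SR.image R ∪ SC.image Cm) ∪ SD.image Dg ∪ K'.image ρ' ⊆ P1 :=
    Finset.union_subset (Finset.union_subset (Finset.union_subset tR tCm) tDg) tρ'
  have d1 : Disjoint (SR.image R ∪ SC.image Cm) (SD.image Dg) := Finset.disjoint_union_left.2 ⟨dRD, dCD⟩
  have d2 : Disjoint ((SR.image R ∪ SC.image Cm) ∪ SD.image Dg) (K'.image ρ') :=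
    Finset.disjoint_union_left.2 ⟨Finset.disjoint_union_left.2 ⟨dρR.symm, dρC.symm⟩, dρD.symm⟩
  have e1 := card_union_add_card_inter (SR.image R) (SC.image Cm)
  have e2 := card_union_of_disjoint d1
  have e3 := card_union_of_disjoint d2
  have e4 := card_le_card hsub
  rw [← hK] at e1
  omega

end HalfCount

end Summit.CriticalPhenomena.PercolationContinuityZ3.Theorems.SahiGridPattern
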